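import Mathlib
import Literature.Barriers.ValiantsHypothesis.AlgebraicNaturalProofs
import Literature.Computability.AlgebraicComplexity.ArithCircuitProofs
import Summits.ValiantsHypothesis.ValiantsHypothesis.Theorems.BarrierLeverNaturalProofsAgainstAllLinearSizesOfCount

/-!
# Route BarrierLever — TEMPLATE, second half (part 1/2): LINEAR (affine) rank methods with a
# largeness witness are algebraically natural proofs with `q = 0`
# (crux `DefinableEquations` stmt-8745 / item `SingleSizeEquations` stmt-8749; val-np-p5 g11)

`…RankTemplate.lean` (g8) packages COORDINATE rank methods whose `r²` matrix entries are DISTINCT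
coefficient variables (then non-vanishing is free).  The classical methods that the g10 wall chart
leaves open — shifted partial derivatives of low order (entries = coefficient variables times
falling factorials, each variable REPEATED along diagonals), Young / Koszul flattenings
(Landsberg–Ottaviani), Ruppert-type PDE matrices, relative-rank matrices after a change of basis —
are not coordinate placements: their matrices `M(c)` have entries that are arbitrary LINEAR (or
affine) forms in the `N = C(2n,n)` coefficient variables, and a variable may occur many times.  For
such a method non-vanishing of a minor needs a LARGENESS WITNESS: one point `c₀ ∈ ℂ^N` (any
polynomial of degree `≤ n`, explicit or not — a generic one will do on paper) with
`rank M(c₀) ≥ r`.  This file proves, once and for all: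

* §1 `eval_minor`, `eval_minor_eq_zero_of_rank_lt` (every `r × r` minor of `M` vanishes at each `c`
  with `rank M(c) < r`), `exists_minor_ne_zero_of_le_rank` (conversely some `r × r` minor is
  nonzero at a point with `rank M(c₀) ≥ r`; row rank = column rank, adapted from the tree's
  `HodgeLocus.Census.RankReduction.exists_submatrix_det_ne_zero`), `complexity_minor_le`
  (`≤ 8(r+1)^7 + r²·B` for entries of complexity `≤ B`, Berkowitz via the tree's
  `NaturalProofsAgainstAllLinearSizes.complexity_det_le`), `totalDegree_minor_le` (`≤ r` for affine
  entries);
* §2 **`exists_isNaturalProof_of_rank_lt`**: if every `f` in a class `𝒞` has `rank M(coeff f) < r`,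
  some `c₀` has `rank M(c₀) ≥ r`, the entries are affine of complexity `≤ B`, and
  `8(r+1)^7 + r²B ≤ N^a`, then some minor of `M` is an FSV natural proof against `𝒞` from
  `Distinguishers ℂ n a`; `not_isSuccinctHittingSet_of_rank_lt` (FSV Thm 4 form);
  **`exists_boolSum_of_rank_lt`** (the crux's clause `Eq(n,·,a)` with `q = 0` Boolean variables).

Part 2 (`…LinearRankTemplateDeterminantal.lean`) identifies the technique class with the class
of `poly(N)`-size DETERMINANTAL distinguishers and records its saturation under Question 6.

READING for the planners (D-0145 lines): a line for item 8749 through ANY linear rank method `M`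
(e.g. low-order shifted partials, the one classical measure the g10 chart does not wall) has
exactly two stubs — the rank gap on the class (`∀ f ∈ SmallCircuits ℂ n b, rank M(coeff f) < r`,
the hard one) and a largeness witness (`∃ c₀, r ≤ rank M(c₀)`, free on paper) — and this file is
its door (`exists_boolSum_of_rank_lt`).  WHAT THIS IS NOT: no rank gap is proved here; nothing
bears on the crux's verdict (b = 2 OPEN) or on `VP ≠ VNP`.  No definitions, no named facts;
standard axioms.
-/

-- `Summit.ValiantsHypothesis.ValiantsHypothesis.…` repeats a component by the D-0017 layout
-- (single-conjunct summit), which the `dupNamespace` linter flags; the name is mandated.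
set_option linter.dupNamespace false

noncomputable section

namespace Summit.ValiantsHypothesis.ValiantsHypothesis.Theorems.BarrierLeverDefinableEquations

open MvPolynomial
open Literature.Computability.AlgebraicComplexity Literature.Barriers.ValiantsHypothesis
open scoped BigOperators

namespace LinearRankTemplate

variable {n R S r : ℕ}

/-! ## §1 Minors of a matrix of polynomials in the coefficient variables -/

/-- Evaluating the `(σ, τ)`-minor of `M` at a point `c` gives the corresponding minor of the
numerical matrix `M(c)`. [folklore] -/
theorem eval_minor (M : Matrix (Fin R) (Fin S) (MvPolynomial ↥(degLEMonomials n) ℂ))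
    (σ : Fin r → Fin R) (τ : Fin r → Fin S) (c : ↥(degLEMonomials n) → ℂ) :
    eval c (M.submatrix σ τ).det = ((M.map (eval c)).submatrix σ τ).det := by
  rw [RingHom.map_det, RingHom.mapMatrix_apply, Matrix.submatrix_map]

/-- **Vanishing from a rank bound**: if the numerical matrix `M(c)` has rank `< r` then every
`r × r` minor of `M` vanishes at `c` (a nonsingular `r × r` submatrix would have rank `r ≤ rank M(c)`).
[folklore] -/
theorem eval_minor_eq_zero_of_rank_lt (M : Matrix (Fin R) (Fin S) (MvPolynomial ↥(degLEMonomials n) ℂ))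
    (c : ↥(degLEMonomials n) → ℂ) (h : (M.map (eval c)).rank < r)
    (σ : Fin r → Fin R) (τ : Fin r → Fin S) : eval c (M.submatrix σ τ).det = 0 := by
  rw [eval_minor]
  by_contra hne
  have hu : IsUnit ((M.map (eval c)).submatrix σ τ) :=
    (Matrix.isUnit_iff_isUnit_det _).mpr (isUnit_iff_ne_zero.mpr hne)
  have hr := Matrix.rank_of_isUnit _ hu
  rw [Fintype.card_fin] at hr
  have hle := Matrix.rank_submatrix_le (M.map (eval c)) σ τ
  omega

/-- Row rank = column rank: a matrix over a field has a nonsingular square submatrix of size its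
rank (adapted from the tree's `HodgeLocus.Census.RankReduction.exists_submatrix_det_ne_zero`).
[folklore] -/
theorem exists_submatrix_det_ne_zero {m k : Type*} [Fintype m] [Fintype k] {L : Type*} [Field L]
    (B : Matrix m k L) :
    ∃ (rows : Fin B.rank → m) (cols : Fin B.rank → k), (B.submatrix rows cols).det ≠ 0 := by
  classical
  obtain ⟨κ, a, ha, hspan, hli⟩ := exists_linearIndependent' L B.col
  haveI : Fintype κ := Fintype.ofInjective a ha
  set C : Matrix m κ L := B.submatrix id a with hC
  have hliC : LinearIndependent L C.col := hli
  have hrankB : B.rank = Fintype.card κ := by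
    rw [Matrix.rank_eq_finrank_span_cols, ← hspan]; exact finrank_span_eq_card hli
  have hrankC : C.rank = Fintype.card κ := by
    rw [Matrix.rank_eq_finrank_span_cols]; exact finrank_span_eq_card hliC
  obtain ⟨κ₂, b, hb, hspan2, hli2⟩ := exists_linearIndependent' L C.row
  haveI : Fintype κ₂ := Fintype.ofInjective b hb
  have hcard : Fintype.card κ₂ = Fintype.card κ := by
    rw [← finrank_span_eq_card hli2, hspan2, ← Matrix.rank_eq_finrank_span_row, hrankC]
  let e : κ₂ ≃ κ := Fintype.equivOfCardEq hcard
  let rows : κ → m := b ∘ e.symm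
  have hrows : LinearIndependent L (B.submatrix rows a).row := by
    have h3 : LinearIndependent L ((C.row ∘ b) ∘ e.symm) := hli2.comp _ e.symm.injective
    have h4 : (B.submatrix rows a).row = (C.row ∘ b) ∘ e.symm := by
      funext i j; rfl
    rw [h4]; exact h3
  have hU : IsUnit (B.submatrix rows a) := Matrix.linearIndependent_rows_iff_isUnit.mp hrows
  have hdet : (B.submatrix rows a).det ≠ 0 := ((Matrix.isUnit_iff_isUnit_det _).mp hU).ne_zero
  let f : κ ≃ Fin B.rank := Fintype.equivFinOfCardEq hrankB.symm
  refine ⟨rows ∘ f.symm, a ∘ f.symm, ?_⟩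
  have h5 : B.submatrix (rows ∘ f.symm) (a ∘ f.symm) =
      (B.submatrix rows a).submatrix f.symm f.symm := by
    funext i j; rfl
  rw [h5, Matrix.det_submatrix_equiv_self]
  exact hdet

/-- **Non-vanishing from a largeness witness**: if `rank M(c₀) ≥ r` then some `r × r` minor of
`M` is nonzero at `c₀` (hence is a nonzero polynomial). [folklore] -/
theorem exists_minor_ne_zero_of_le_rank
    (M : Matrix (Fin R) (Fin S) (MvPolynomial ↥(degLEMonomials n) ℂ))
    (c₀ : ↥(degLEMonomials n) → ℂ) (h : r ≤ (M.map (eval c₀)).rank) :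
    ∃ (σ : Fin r → Fin R) (τ : Fin r → Fin S), eval c₀ (M.submatrix σ τ).det ≠ 0 := by
  classical
  obtain ⟨rows, cols, hdet⟩ := exists_submatrix_det_ne_zero (M.map (eval c₀))
  -- restrict the nonsingular `rank × rank` submatrix to its first `r` rows and columns? No: a
  -- principal restriction of a nonsingular matrix may be singular.  Instead: the `r` selected
  -- rows are linearly independent, so some `r` of the selected columns keep them independent.
  let ι : Fin r → Fin (M.map (eval c₀)).rank := Fin.castLE h
  have hι : Function.Injective ι := Fin.castLE_injective h
  set A := (M.map (eval c₀)).submatrix rows cols with hA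
  have hUA : IsUnit A := (Matrix.isUnit_iff_isUnit_det _).mpr (isUnit_iff_ne_zero.mpr hdet)
  have hrowsA : LinearIndependent ℂ A.row := Matrix.linearIndependent_rows_iff_isUnit.mpr hUA
  -- rows `ι i` of `A`, as an `r × rank` matrix, are independent
  have hli : LinearIndependent ℂ (A.submatrix ι id).row := hrowsA.comp ι hι
  -- pick `r` columns keeping them independent: via `exists_submatrix_det_ne_zero` on this matrix
  obtain ⟨rows', cols', hdet'⟩ := exists_submatrix_det_ne_zero (A.submatrix ι id)
  have hrk : (A.submatrix ι id).rank = r := by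
    have := hli.rank_matrix
    simpa [Fintype.card_fin] using this
  -- transport along `Fin (rank) = Fin r`
  refine ⟨rows ∘ ι ∘ rows' ∘ Fin.cast hrk.symm,
    cols ∘ cols' ∘ Fin.cast hrk.symm, ?_⟩
  rw [eval_minor]
  have hsub : (M.map (eval c₀)).submatrix (rows ∘ ι ∘ rows' ∘ Fin.cast hrk.symm)
      (cols ∘ cols' ∘ Fin.cast hrk.symm) =
      ((A.submatrix ι id).submatrix rows' cols').submatrix (Fin.cast hrk.symm) (Fin.cast hrk.symm) := by
    funext i j; rfl
  rw [hsub]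
  let e : Fin r ≃ Fin (A.submatrix ι id).rank := finCongr hrk.symm
  have : ((A.submatrix ι id).submatrix rows' cols').submatrix (Fin.cast hrk.symm) (Fin.cast hrk.symm)
      = ((A.submatrix ι id).submatrix rows' cols').submatrix e e := by
    funext i j; rfl
  rw [this, Matrix.det_submatrix_equiv_self]
  exact hdet'

/-- Size of a minor: `≤ 8(r+1)^7 + r²·B` when every entry of `M` has complexity `≤ B` (Berkowitz,
tree `NaturalProofsAgainstAllLinearSizes.complexity_det_le`). [folklore] -/
theorem complexity_minor_le (M : Matrix (Fin R) (Fin S) (MvPolynomial ↥(degLEMonomials n) ℂ))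
    {B : ℕ} (hB : ∀ i j, complexity (M i j) ≤ B) (σ : Fin r → Fin R) (τ : Fin r → Fin S) :
    complexity (M.submatrix σ τ).det ≤ 8 * (r + 1) ^ 7 + r ^ 2 * B := by
  have h := BarrierLever.NaturalProofsAgainstAllLinearSizes.complexity_det_le (M.submatrix σ τ) B
    (fun i j => hB _ _)
  simpa [Fintype.card_fin] using h

/-- Degree of a minor: `≤ r` when every entry of `M` is affine (`totalDegree ≤ 1`). [folklore] -/
theorem totalDegree_minor_le (M : Matrix (Fin R) (Fin S) (MvPolynomial ↥(degLEMonomials n) ℂ))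
    (hdeg : ∀ i j, (M i j).totalDegree ≤ 1) (σ : Fin r → Fin R) (τ : Fin r → Fin S) :
    (M.submatrix σ τ).det.totalDegree ≤ r := by
  have h := BarrierLever.NaturalProofsAgainstAllLinearSizes.totalDegree_det_le_card (M.submatrix σ τ)
    (fun i j => hdeg _ _)
  simpa [Fintype.card_fin] using h

/-! ## §2 FSV packaging: an affine rank method with a largeness witness is a `q = 0` natural proof -/

/-- Level bookkeeping for minors. [folklore] -/
theorem minor_mem_distinguishers (M : Matrix (Fin R) (Fin S) (MvPolynomial ↥(degLEMonomials n) ℂ))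
    {B : ℕ} (hB : ∀ i j, complexity (M i j) ≤ B) (hdeg : ∀ i j, (M i j).totalDegree ≤ 1)
    {a : ℕ} (ha : 8 * (r + 1) ^ 7 + r ^ 2 * B ≤ Nat.choose (2 * n) n ^ a)
    (σ : Fin r → Fin R) (τ : Fin r → Fin S) :
    (M.submatrix σ τ).det ∈ Distinguishers ℂ n a := by
  refine ⟨(complexity_minor_le M hB σ τ).trans ha, (totalDegree_minor_le M hdeg σ τ).trans ?_⟩
  calc r ≤ r + 1 := Nat.le_succ r
    _ ≤ (r + 1) ^ 7 := Nat.le_self_pow (by norm_num) _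
    _ ≤ 8 * (r + 1) ^ 7 := Nat.le_mul_of_pos_left _ (by norm_num)
    _ ≤ 8 * (r + 1) ^ 7 + r ^ 2 * B := Nat.le_add_right _ _
    _ ≤ Nat.choose (2 * n) n ^ a := ha

/-- **TEMPLATE (affine rank methods are algebraically natural, `q = 0`).**  Let `M` be an
`R × S` matrix whose entries are AFFINE forms in the coefficient variables, each of complexity
`≤ B`.  If every `f` in a class `𝒞` has `rank M(coeff f) < r`, some point `c₀` has
`rank M(c₀) ≥ r`, and `8(r+1)^7 + r²B ≤ N^a`, then some `r × r` minor of `M` is an FSV natural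
proof against `𝒞` from `Distinguishers ℂ n a`.  Coordinate placements (`…RankTemplate`) are the
case `B = 1`, `c₀` = the indicator of a transversal. [cite: ForbesShpilkaVolk2018, Def. 1] -/
theorem exists_isNaturalProof_of_rank_lt
    (M : Matrix (Fin R) (Fin S) (MvPolynomial ↥(degLEMonomials n) ℂ))
    {B : ℕ} (hB : ∀ i j, complexity (M i j) ≤ B) (hdeg : ∀ i j, (M i j).totalDegree ≤ 1)
    {𝒞 : Set (MvPolynomial (Fin n) ℂ)}
    (hrank : ∀ f ∈ 𝒞, (M.map (eval (coeffVector (degLEMonomials n) f))).rank < r)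
    (c₀ : ↥(degLEMonomials n) → ℂ) (hc₀ : r ≤ (M.map (eval c₀)).rank)
    {a : ℕ} (ha : 8 * (r + 1) ^ 7 + r ^ 2 * B ≤ Nat.choose (2 * n) n ^ a) :
    ∃ D, IsNaturalProof (degLEMonomials n) 𝒞 (Distinguishers ℂ n a) D := by
  obtain ⟨σ, τ, hne⟩ := exists_minor_ne_zero_of_le_rank M c₀ hc₀
  refine ⟨(M.submatrix σ τ).det, minor_mem_distinguishers M hB hdeg ha σ τ, ?_, fun f hf => ?_⟩
  · intro h0; rw [h0, map_zero] at hne; exact hne rfl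
  · exact eval_minor_eq_zero_of_rank_lt M _ (hrank f hf) σ τ

/-- Hitting-set form of the template (FSV Thm 4). [cite: ForbesShpilkaVolk2018, Thm. 4] -/
theorem not_isSuccinctHittingSet_of_rank_lt
    (M : Matrix (Fin R) (Fin S) (MvPolynomial ↥(degLEMonomials n) ℂ))
    {B : ℕ} (hB : ∀ i j, complexity (M i j) ≤ B) (hdeg : ∀ i j, (M i j).totalDegree ≤ 1)
    {𝒞 : Set (MvPolynomial (Fin n) ℂ)}
    (hrank : ∀ f ∈ 𝒞, (M.map (eval (coeffVector (degLEMonomials n) f))).rank < r)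
    (c₀ : ↥(degLEMonomials n) → ℂ) (hc₀ : r ≤ (M.map (eval c₀)).rank)
    {a : ℕ} (ha : 8 * (r + 1) ^ 7 + r ^ 2 * B ≤ Nat.choose (2 * n) n ^ a) :
    ¬ IsSuccinctHittingSet (degLEMonomials n) 𝒞 (Distinguishers ℂ n a) := by
  rw [← exists_isNaturalProof_iff]
  exact exists_isNaturalProof_of_rank_lt M hB hdeg hrank c₀ hc₀ ha

/-- **Door for item 8749 through any affine rank method** (the crux's clause `Eq(n,·,a)` with
`q = 0` Boolean variables): under the hypotheses of the template there are `q ≤ N^a` (namely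
`q = 0`) and `H` with `L(H), deg H ≤ N^a`, `boolSum H ≠ 0`, vanishing on `coeff(𝒞)`.
[cite: ForbesShpilkaVolk2018, Def. 1] -/
theorem exists_boolSum_of_rank_lt
    (M : Matrix (Fin R) (Fin S) (MvPolynomial ↥(degLEMonomials n) ℂ))
    {B : ℕ} (hB : ∀ i j, complexity (M i j) ≤ B) (hdeg : ∀ i j, (M i j).totalDegree ≤ 1)
    {𝒞 : Set (MvPolynomial (Fin n) ℂ)}
    (hrank : ∀ f ∈ 𝒞, (M.map (eval (coeffVector (degLEMonomials n) f))).rank < r)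
    (c₀ : ↥(degLEMonomials n) → ℂ) (hc₀ : r ≤ (M.map (eval c₀)).rank)
    {a : ℕ} (ha : 8 * (r + 1) ^ 7 + r ^ 2 * B ≤ Nat.choose (2 * n) n ^ a) :
    ∃ q : ℕ, q ≤ Nat.choose (2 * n) n ^ a ∧
      ∃ H : MvPolynomial (↥(degLEMonomials n) ⊕ Fin q) ℂ,
        complexity H ≤ Nat.choose (2 * n) n ^ a ∧ H.totalDegree ≤ Nat.choose (2 * n) n ^ a ∧
        boolSum H ≠ 0 ∧ ∀ f ∈ 𝒞, eval (coeffVector (degLEMonomials n) f) (boolSum H) = 0 := by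
  obtain ⟨D, hD, hne, hvan⟩ := exists_isNaturalProof_of_rank_lt M hB hdeg hrank c₀ hc₀ ha
  have hbs : boolSum (m := 0) (MvPolynomial.rename Sum.inl D) = D := by
    rw [boolSum, Fintype.sum_unique, MvPolynomial.aeval_rename, Sum.elim_comp_inl,
      MvPolynomial.aeval_X_left, AlgHom.coe_id, id_eq]
  refine ⟨0, Nat.zero_le _, MvPolynomial.rename Sum.inl D, ?_, ?_, ?_, ?_⟩
  · exact (complexity_rename_le_holds' _ _).trans hD.1
  · exact (MvPolynomial.totalDegree_rename_le _ _).trans hD.2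
  · rwa [hbs]
  · intro f hf; rw [hbs]; exact hvan f hf

/-- Witness given as a POLYNOMIAL `g` (of any degree; only its coefficients of degree `≤ n`
enter): the form in which rank methods are stated on paper ("`μ(f) < r` on the class,
`μ(g) ≥ r` for an explicit or generic `g`"). [cite: ForbesShpilkaVolk2018, Def. 1] -/
theorem exists_boolSum_of_rank_lt' (M : Matrix (Fin R) (Fin S) (MvPolynomial ↥(degLEMonomials n) ℂ))
    {B : ℕ} (hB : ∀ i j, complexity (M i j) ≤ B) (hdeg : ∀ i j, (M i j).totalDegree ≤ 1)
    {𝒞 : Set (MvPolynomial (Fin n) ℂ)}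
    (hrank : ∀ f ∈ 𝒞, (M.map (eval (coeffVector (degLEMonomials n) f))).rank < r)
    (g : MvPolynomial (Fin n) ℂ) (hg : r ≤ (M.map (eval (coeffVector (degLEMonomials n) g))).rank)
    {a : ℕ} (ha : 8 * (r + 1) ^ 7 + r ^ 2 * B ≤ Nat.choose (2 * n) n ^ a) :
    ∃ q : ℕ, q ≤ Nat.choose (2 * n) n ^ a ∧
      ∃ H : MvPolynomial (↥(degLEMonomials n) ⊕ Fin q) ℂ,
        complexity H ≤ Nat.choose (2 * n) n ^ a ∧ H.totalDegree ≤ Nat.choose (2 * n) n ^ a ∧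
        boolSum H ≠ 0 ∧ ∀ f ∈ 𝒞, eval (coeffVector (degLEMonomials n) f) (boolSum H) = 0 :=
  exists_boolSum_of_rank_lt M hB hdeg hrank _ hg ha


end LinearRankTemplate

end Summit.ValiantsHypothesis.ValiantsHypothesis.Theorems.BarrierLeverDefinableEquations
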